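import Literature.NumberTheory.LFunctions.Equivalents
import Literature.NumberTheory.LFunctions.ZeroGaps
import HarnessLib

/-!
# Rodgers–Tao, *The de Bruijn–Newman constant is non-negative*: architecture of the proof

Trunk T-ANT (`Literature/NumberTheory/LFunctions`). Decomposition file (D-0014 named facts) for
the discharge of `Literature.NumberTheory.LFunctions.rodgers_tao` (`Literature/NumberTheory/LFunctions/Equivalents.lean`,
rh.S28): `∀ t < 0, ¬ HasOnlyRealZeros (deBruijnH t)`, the `sInf`-free form of

> **Theorem 1.1** (Rodgers–Tao, Forum Math. Pi 8 (2020)). `Λ ≥ 0`.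

(`Λ = inf {t | H_t has only real zeros}`; `Λ ≥ 0` says precisely that no `t < 0` belongs to that
set.) The printed proof (27 pp. in arXiv:1801.05914; section numbers below are those of the arXiv
version) is by contradiction from the standing assumption

> (§1.2) `Λ < 0`, i.e. `H_{t₀}` has only real zeros for some `t₀ < 0`,

which implies RH and, by Csordas–Smith–Varga, that for `Λ < t ≤ 0` the zeros of `H_t` are real
and simple, `0 < x_1(t) < x_2(t) < ⋯` and `x_{-j} = -x_j`. Its architecture:

* §2 (Lemma 2.1) saddle-point asymptotics of `H_t(x − iκ log x)`; §3 (Thm. 3.2, Cor. 3.3)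
  Riemann–von Mangoldt formulae for the zeros of `H_t`, `Λ < t ≤ 0`, and the "classical
  locations" `ξ_j ∼ 4πj / log j`;
* §4 (Thm. 4.1, after Csordas–Smith–Varga) the zeros move by `∂ₜ x_k = 2 ∑' 1/(x_k − x_j)`;
* §§5–8 (Prop. 5.1, Prop. 6.1, Thm. 7.2, Prop. 8.1) gap bounds, Hamiltonian and energy
  estimates along this flow, ending in the *energy bound at time zero*
  `Ẽ^{[T log T, 2T log T]}(0) = o(T log³ T)`;
* §9: Prop. 8.1 and Markov's inequality give the **picket-fence estimate** (display
  (picketfence) of §9): `x_{j+1}(0) − x_j(0) = (4π + o(1)) / log T` for all but a fraction `o(1)`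
  of the `j ∈ [T log T, 2T log T]`; "since the points `x_j(0)` are twice the imaginary ordinates
  of nontrivial zeroes of the Riemann zeta function, this implies that the gaps between the
  zeroes of the zeta function are rarely much larger or smaller than the mean spacing", which
  contradicts the fact that a positive proportion of consecutive zeros are noticeably closer than
  the mean spacing (Montgomery 1973; Conrey–Ghosh–Goldston–Gonek–Heath-Brown 1985).

## Contents (this file: the top-level cut of §9)

* `Literature.NumberTheory.LFunctions.rodgers_tao_picket_fence` — NAMED FACT: under `Λ < 0`, the picket-fence estimate of
  §9 for the ordinates `γ_n` of the zeros of `ζ` (the whole of §§2–8 plus the first display of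
  §9; this is the analytic heart of the paper and is *not* proved here).
* `Literature.NumberTheory.LFunctions.rodgers_tao_gaps_near_mean` — NAMED FACT: under `Λ < 0`, for every `ε > 0` all but at
  most `ε N(T)` of the `n < N(T)` have normalised gap `(γ_{n+1} − γ_n)/(2π/log γ_n)` within `ε`
  of `1` (the sentence of §9 quoted above). In the source this follows from the picket-fence
  estimate by covering the indices `n < N(T) ≍ T log T` with dyadic windows
  `[T' log T', 2T' log T']` and `N(T) ∼ (T/2π) log T`, `log γ_n ∼ log n` (Titchmarsh §9.3–9.4);
  that elementary bridge is the object of a planned companion file (`RodgersTaoProofs.lean`).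
* `Literature.NumberTheory.LFunctions.rodgers_tao_of_gaps_near_mean` — PROVED: the last paragraph of §9. The fact
  `rodgers_tao_gaps_near_mean`, the Selberg–Fujii small-gap theorem
  `Literature.NumberTheory.LFunctions.selberg_fujii_small_gaps` (Titchmarsh (9.25.6); unconditional stand-in for the
  RH-conditional CGGGH theorem quoted in the source — under `Λ < 0` RH holds anyway) and
  `N(T) → ∞` (`Literature.NumberTheory.LFunctions.tendsto_zetaZeroCount_atTop`) imply `rodgers_tao`. A variant
  `rodgers_tao_of_gaps_near_mean'` uses the large-gap theorem (9.25.5) instead.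
* `Literature.NumberTheory.LFunctions.rodgers_tao_iff` — `rodgers_tao ↔ ∀ t < 0, ∃ z, H_t z = 0 ∧ Im z ≠ 0`, and
  `Literature.NumberTheory.LFunctions.rodgers_tao_of_deBruijnNewmanConst_nonneg` — the printed form `0 ≤ Λ` gives back the
  `sInf`-free one. (The converse, `rodgers_tao → 0 ≤ Λ`, is already the tree's
  `Literature.NumberTheory.LFunctions.deBruijnNewmanConst_nonneg_of_rodgers_tao` in
  `Literature/NumberTheory/LFunctions/DeBruijnNewmanConstProofs.lean` and is not repeated.)

## Design choices

* The standing hypothesis `Λ < 0` is written `sInf`-free, as `∃ t < 0, HasOnlyRealZeros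
  (deBruijnH t)`; with de Bruijn's monotonicity, nonemptiness and Newman's lower bound
  (`Literature.NumberTheory.LFunctions.HasOnlyRealZeros.mono_deBruijnH`, `Literature.NumberTheory.LFunctions.hasOnlyRealZeros_deBruijnH_one_half`,
  `Literature.NumberTheory.LFunctions.bddBelow_setOf_hasOnlyRealZeros`) it is equivalent to `deBruijnNewmanConst < 0`, and its
  negation is literally `rodgers_tao`. Every intermediate result of a proof by contradiction is an
  implication from this (refuted) hypothesis; as named facts they are exactly as strong as the
  sections of the paper they summarise, and their discharge is the formalisation of those
  sections.
* The zeros `x_j(0)` of `H_0(z) = ξ(1/2 + iz/2)/8` versus the ordinates `γ_n`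
  (`Literature.NumberTheory.LFunctions.zetaOrdinate`, 0-indexed, with multiplicity): under `Λ < 0` all zeros of `ζ` are on the
  critical line and simple (RH from `Λ ≤ 0`; simplicity by Csordas–Smith–Varga 1994, as quoted
  in §1.2 of the source), so `x_j(0) = 2 γ_{j-1}` and
  `(x_{j+1}(0) − x_j(0)) log T / (4π) = (γ_j − γ_{j-1}) log T / (2π)`. The facts are therefore
  stated directly for `zetaOrdinate`, which is how §9 uses them ("twice the imaginary
  ordinates"). The shift of the window by one index changes every count by at most `1 =
  o(T log T)` and is absorbed in the `ε`-formulation.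
* "`= (4π + o(1))/log T` for a fraction `1 − o(1)` of `j ∈ [T log T, 2T log T]`" is rendered with
  one `ε` for both rates: `∀ ε > 0, ∃ T₀, ∀ T ≥ T₀, #{exceptional j in the window} ≤ ε · T log T`
  (the window has `(1 + o(1)) T log T` elements).

## References

* B. Rodgers, T. Tao, *The de Bruijn–Newman constant is non-negative*, Forum Math. Pi 8 (2020),
  e6; arXiv:1801.05914: Thm. 1.1, §1.2, Prop. 8.1, §9 (display (picketfence) and the final
  paragraph).
* G. Csordas, W. Smith, R. S. Varga, *Lehmer pairs of zeros, the de Bruijn–Newman constant `Λ`,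
  and the Riemann Hypothesis*, Constr. Approx. 10 (1994), 107–129 (simplicity and dynamics of the
  zeros for `t > Λ`).
* J. B. Conrey, A. Ghosh, D. Goldston, S. M. Gonek, D. R. Heath-Brown, *On the distribution of
  gaps between zeros of the zeta-function*, Quart. J. Math. Oxford (2) 36 (1985), 43–51.
* E. C. Titchmarsh, *The Theory of the Riemann Zeta-Function*, 2nd ed. (1986), §9.25–9.26
  (Selberg–Fujii), Thm. 9.4 (Riemann–von Mangoldt).
* A. Dobner, *A proof of Newman's conjecture for the extended Selberg class*, arXiv:2005.05142
  (an independent analytic proof of Thm. 1.1, not used here).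
-/

noncomputable section

open Real Filter

namespace Literature.NumberTheory.LFunctions

/-! ## The two facts extracted from §9 -/

/-- NAMED FACT (Rodgers–Tao 2020, §9, display (picketfence), obtained there from the energy bound
at time zero, Prop. 8.1, by Markov's inequality; it rests on all of §§2–8). Assume `Λ < 0`, i.e.
`H_{t₀}` has only real zeros for some `t₀ < 0`. Then for every `ε > 0` and all sufficiently large
`T`, all but at most `ε · T log T` of the indices `n` with `T log T ≤ n ≤ 2T log T` satisfy
`|(γ_{n+1} − γ_n) log T / (2π) − 1| ≤ ε`; in the notation of the source (`x_j(0) = 2γ_{j−1}` the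
positive zeros of `H_0`, simple under `Λ < 0`): `x_{j+1}(0) − x_j(0) = (4π + o(1))/log T` for a
fraction `1 − o(1)` of `j ∈ [T log T, 2T log T]`. Since the conclusion is unconditionally false
(Selberg–Fujii), this fact is equivalent to `rodgers_tao` over unconditional facts: its discharge
must formalise the content of §§2–8 of the source (see `RodgersTaoEnergy.lean`), never invoke a
proof of `rodgers_tao`. Users take `(h : rodgers_tao_picket_fence)`.
[cite: RodgersTaoFMP2020, §9 eq. (picketfence) and Prop. 8.1] -/
def rodgers_tao_picket_fence : Prop :=
  (∃ t : ℝ, t < 0 ∧ HasOnlyRealZeros (deBruijnH t)) →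
    ∀ ε : ℝ, 0 < ε → ∃ T₀ : ℝ, ∀ T : ℝ, T₀ ≤ T →
      (((Finset.Icc ⌈T * Real.log T⌉₊ ⌊2 * T * Real.log T⌋₊).filter fun n ↦
          ε < |(zetaOrdinate (n + 1) - zetaOrdinate n) * Real.log T / (2 * π) - 1|).card : ℝ)
        ≤ ε * (T * Real.log T)

/-- NAMED FACT (Rodgers–Tao 2020, §9, the sentence following (picketfence): under `Λ < 0` "the
gaps between the zeroes of the zeta function are rarely much larger or smaller than the mean
spacing"). Assume `H_{t₀}` has only real zeros for some `t₀ < 0`. Then for every `ε > 0` and all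
sufficiently large `T`, at most `ε · N(T)` of the indices `n < N(T)` (i.e. `0 < γ_n ≤ T`) have a
normalised gap `δ_n = (γ_{n+1} − γ_n)/(2π/log γ_n)` with `|δ_n − 1| > ε`. In the source this is
read off from (picketfence) with `N(T) ∼ (T/2π) log T` and `log γ_n ∼ log n` (dyadic windows;
bridge in the companion file `RodgersTaoProofs.lean`). As for `rodgers_tao_picket_fence`, the
conclusion is unconditionally false, so a discharge must come from the §§2–8 content of the
source, never from a proof of `rodgers_tao`. Users take `(h : rodgers_tao_gaps_near_mean)`.
[cite: RodgersTaoFMP2020, §9 (sentence after eq. (picketfence))] -/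
def rodgers_tao_gaps_near_mean : Prop :=
  (∃ t : ℝ, t < 0 ∧ HasOnlyRealZeros (deBruijnH t)) →
    ∀ ε : ℝ, 0 < ε → ∃ T₀ : ℝ, ∀ T : ℝ, T₀ ≤ T →
      (((Finset.range (zetaZeroCount T)).filter fun n ↦
          ε < |zetaNormalizedGap n - 1|).card : ℝ) ≤ ε * (zetaZeroCount T : ℝ)

/-! ## The last paragraph of §9: contradiction with a positive proportion of off-mean gaps -/

/-- The final step of Rodgers–Tao 2020, §9, in abstract form: if under `Λ < 0` the normalised gaps
are within `ε` of `1` for all but `ε N(T)` indices `n < N(T)` (every `ε > 0`, `T` large), while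
unconditionally a positive proportion `A · N(T)` of the `n < N(T)` have `|δ_n − 1| ≥ η` for some
fixed `η > 0`, and `N(T) → ∞`, then `Λ < 0` is impossible: for every `t < 0`, `H_t` has a
non-real zero. [cite: RodgersTaoFMP2020, §9 (final paragraph)] -/
theorem rodgers_tao_of_gaps_near_mean_of_proportion (h₁ : rodgers_tao_gaps_near_mean)
    (h₂ : ∃ η : ℝ, 0 < η ∧ ∃ A : ℝ, 0 < A ∧ ∃ T₀ : ℝ, ∀ T : ℝ, T₀ ≤ T →
      A * (zetaZeroCount T : ℝ) ≤
        (((Finset.range (zetaZeroCount T)).filter fun n ↦ η ≤ |zetaNormalizedGap n - 1|).card :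
          ℝ))
    (h₃ : tendsto_zetaZeroCount_atTop) : rodgers_tao := by
  intro t ht hreal
  obtain ⟨η, hη, A, hA, T₁, hT₁⟩ := h₂
  set ε : ℝ := min (A / 2) (η / 2) with hε_def
  have hε : 0 < ε := lt_min (by linarith) (by linarith)
  have hεA : ε ≤ A / 2 := min_le_left _ _
  have hεη : ε < η := (min_le_right _ _).trans_lt (by linarith)
  obtain ⟨T₂, hT₂⟩ := h₁ ⟨t, ht, hreal⟩ ε hε
  -- a height `T` beyond both thresholds with `N(T) ≥ 1`
  have hev : ∀ᶠ T in atTop, 1 ≤ zetaZeroCount T ∧ max T₁ T₂ ≤ T :=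
    (h₃.eventually (eventually_ge_atTop 1)).and (eventually_ge_atTop _)
  obtain ⟨T, hNT, hT⟩ := hev.exists
  have hlow := hT₁ T ((le_max_left _ _).trans hT)
  have hup := hT₂ T ((le_max_right _ _).trans hT)
  -- indices with `|δ_n - 1| ≥ η` are exceptional at level `ε < η`
  have hsub : (((Finset.range (zetaZeroCount T)).filter fun n ↦
      η ≤ |zetaNormalizedGap n - 1|).card : ℝ) ≤
      (((Finset.range (zetaZeroCount T)).filter fun n ↦
      ε < |zetaNormalizedGap n - 1|).card : ℝ) := by
    exact_mod_cast Finset.card_le_card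
      (Finset.monotone_filter_right _ fun n _ hn ↦ hεη.trans_le hn)
  have hN : (1 : ℝ) ≤ zetaZeroCount T := by exact_mod_cast hNT
  have hchain : A * (zetaZeroCount T : ℝ) ≤ A / 2 * zetaZeroCount T :=
    (hlow.trans (hsub.trans hup)).trans (mul_le_mul_of_nonneg_right hεA (by positivity))
  nlinarith

/-- **Rodgers–Tao 2020, Thm. 1.1, from the named facts** (last paragraph of §9). The picket-fence
consequence `rodgers_tao_gaps_near_mean` of `Λ < 0`, the Selberg–Fujii theorem that a positive
proportion of consecutive zeros of `ζ` are at most `μ < 1` mean spacings apart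
(`Literature.NumberTheory.LFunctions.selberg_fujii_small_gaps`, Titchmarsh (9.25.6); the source quotes the RH-conditional
Conrey–Ghosh–Goldston–Gonek–Heath-Brown version, and RH holds under `Λ < 0`), and `N(T) → ∞`
(`Literature.NumberTheory.LFunctions.tendsto_zetaZeroCount_atTop`) together give `rodgers_tao`: for every `t < 0`, `H_t` has a
non-real zero. [cite: RodgersTaoFMP2020, Thm. 1.1 and §9] -/
theorem rodgers_tao_of_gaps_near_mean (h₁ : rodgers_tao_gaps_near_mean)
    (h₂ : selberg_fujii_small_gaps) (h₃ : tendsto_zetaZeroCount_atTop) : rodgers_tao :=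
  rodgers_tao_of_gaps_near_mean_of_proportion h₁ h₂.exists_far_from_one h₃

/-- Variant of `rodgers_tao_of_gaps_near_mean` using the positive proportion of *large* gaps
(`Literature.NumberTheory.LFunctions.selberg_fujii_large_gaps`, Titchmarsh (9.25.5)) instead of small ones.
[cite: RodgersTaoFMP2020, Thm. 1.1 and §9] -/
theorem rodgers_tao_of_gaps_near_mean' (h₁ : rodgers_tao_gaps_near_mean)
    (h₂ : selberg_fujii_large_gaps) (h₃ : tendsto_zetaZeroCount_atTop) : rodgers_tao :=
  rodgers_tao_of_gaps_near_mean_of_proportion h₁ h₂.exists_far_from_one h₃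

/-! ## Reformulations of the conclusion -/

/-- `rodgers_tao` unfolded: for every `t < 0` the entire function `H_t` has a zero off the real
axis. [cite: RodgersTaoFMP2020, Thm. 1.1] -/
theorem rodgers_tao_iff :
    rodgers_tao ↔ ∀ t : ℝ, t < 0 → ∃ z : ℂ, deBruijnH t z = 0 ∧ z.im ≠ 0 := by
  simp only [rodgers_tao, HasOnlyRealZeros, not_forall, exists_prop]

/-- The printed form `0 ≤ Λ` (`Literature.NumberTheory.LFunctions.deBruijnNewmanConst_nonneg`) gives back the `sInf`-free
statement, given Newman's lower bound `Literature.NumberTheory.LFunctions.bddBelow_setOf_hasOnlyRealZeros` (needed for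
`csInf_le`; it is discharged as `Literature.NumberTheory.LFunctions.bddBelow_setOf_hasOnlyRealZeros_holds` in
`Literature/NumberTheory/LFunctions/DeBruijnNewmanConstProofs.lean`, which this file does not
import). Together with the tree's `Literature.NumberTheory.LFunctions.deBruijnNewmanConst_nonneg_of_rodgers_tao` (same file)
the two forms of Thm. 1.1 are equivalent over proved facts. [cite: RodgersTaoFMP2020, Thm. 1.1] -/
theorem rodgers_tao_of_deBruijnNewmanConst_nonneg (h : deBruijnNewmanConst_nonneg)
    (h₁ : bddBelow_setOf_hasOnlyRealZeros) : rodgers_tao := by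
  intro t ht hreal
  have : deBruijnNewmanConst ≤ t := csInf_le h₁ hreal
  exact absurd (h.trans this) (not_le.2 ht)

end Literature.NumberTheory.LFunctions

end
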